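import Summits.QuantumFields.QCD.Theorems.PauliWegnerSeaPhaseQuenchedFlavourDecayGramSpectral
import Literature.MathematicalPhysics.QuantumFieldTheory.QCDPhaseQuenchedPositivity
import Literature.MathematicalPhysics.QuantumFieldTheory.QCDPhaseQuenchedMomentUpgrade

/-!
# The integrability conjunct of `GramMoments` for EVERY minor size `r` (single-flavour row sets)
(crux stmt-QuantumFields-9151 `PauliWegnerSea.PhaseQuenchedFlavourDecay`, line `crossing-split-integrability`, lead c4 —
registered additive stub `stub_gramMomentIntegrableOf`)

For rows `I : Fin r → QuarkIdx` of ONE flavour `f`, the principal `r × r` minor of the inverse fermion Gram matrix is, off the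
singular null set, `det(((D_fᴴD_f)⁻¹)[I,I]) = det((D_fᴴD_f)[J,J]) / |det D_f|²` (JACOBI, `J` an enumeration of the complement;
the complementary block is the Gram matrix of the columns `J` of `D_f`, non-singular).  Hence
`∏_g |det D_g| · (Re det((GGᴴ)[(f,I),(f,I)]))^q ≤ B · C^q · |det D_f|^{-(2q-1)}` EVERYWHERE (the density vanishes on the
singular set), and the uniform-window negative moments of the Wilson determinant give: for `1/2 < q < (1+s₀)/2`, every `N_f`,
torus of side `≥ 4`, `β`, mass vector, flavour, `r` and `I`, the core's integrand `(Re det((GGᴴ)[I,I]))^q` is integrable under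
`qcdLatticeMeasure` — the integrability conjunct of `stub_gramMomentsCore` for all `r`, with an `r`-INDEPENDENT exponent window.
Inputs as hypotheses: the negative-moment statement (`stub_wilsonDetNegMoment`), Jacobi's identity
(`stub_jacobiComplementaryMinor`) and the non-singularity of the Gram matrix of columns (`stub_gramOfColumns_det_ne_zero`),
all landed.  Mixed-flavour row sets (block-diagonal Gram matrix, window shrinking with the number of distinct flavours by
Hölder) are not treated here.
-/

noncomputable section

namespace Summit.QuantumFields.QCD.Cruxes.PhaseQuenchedFlavourDecay.CrossingSplitIntegrability

open scoped BigOperators ENNReal ComplexConjugate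
open MeasureTheory Filter Set Matrix
open Literature.MathematicalPhysics.QuantumFieldTheory Literature.MathematicalPhysics.QuantumLattice
  Literature.Probability.LatticeModels

section AllR

variable
  (hNeg : ∃ s₀ : ℝ, 0 < s₀ ∧ ∀ s : ℝ, 0 < s → s < s₀ → ∀ (L : ℕ) [NeZero L], 4 ≤ L → ∀ (β M : ℝ),
    Integrable (fun U : GaugeConfig 4 L SU3 => ‖(wilsonDirac (fundamentalRep (Fin 3)) U M 1).det‖ ^ (-s))
      (wilsonMeasure (fundamentalRep (Fin 3)) β))
  (hJac : ∀ (n : Type) [Fintype n] [DecidableEq n] (r k : ℕ) (M : Matrix n n ℂ) (I : Fin r → n) (J : Fin k → n),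
    Function.Injective I → Function.Injective J → (∀ a b, I a ≠ J b) → (∀ x, (∃ a, I a = x) ∨ (∃ b, J b = x)) →
    M.det ≠ 0 → (M.submatrix J J).det ≠ 0 → ((M⁻¹).submatrix I I).det * M.det = (M.submatrix J J).det)
  (hCols : ∀ (n : Type) [Fintype n] [DecidableEq n] (k : ℕ) (D : Matrix n n ℂ) (J : Fin k → n),
    Function.Injective J → D.det ≠ 0 → ((D.submatrix id J).conjTranspose * D.submatrix id J).det ≠ 0)

variable {Nf L : ℕ} [NeZero L]

/-- An enumeration of the complement of the range of an injective map into a finite type. -/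
theorem exists_compl_enum {n : Type} [Fintype n] [DecidableEq n] {r : ℕ} (I : Fin r → n) :
    ∃ (k : ℕ) (J : Fin k → n), Function.Injective J ∧ (∀ a b, I a ≠ J b) ∧ (∀ x, (∃ a, I a = x) ∨ (∃ b, J b = x)) := by
  classical
  set S : Finset n := Finset.univ.filter fun x => x ∉ Set.range I with hS
  refine ⟨S.card, fun b => (S.equivFin.symm b).1, ?_, ?_, ?_⟩
  · intro b b' h
    exact S.equivFin.symm.injective (Subtype.ext h)
  · intro a b h
    have hb : ((S.equivFin.symm b).1) ∈ Finset.univ.filter fun x => x ∉ Set.range I := (S.equivFin.symm b).2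
    rw [Finset.mem_filter] at hb
    exact hb.2 ⟨a, h⟩
  · intro x
    by_cases hx : x ∈ Set.range I
    · obtain ⟨a, ha⟩ := hx; exact Or.inl ⟨a, ha⟩
    · have hxS : x ∈ S := by rw [hS, Finset.mem_filter]; exact ⟨Finset.mem_univ x, hx⟩
      refine Or.inr ⟨S.equivFin ⟨x, hxS⟩, ?_⟩
      simp

/-- `D⁻¹ (D⁻¹)ᴴ = (Dᴴ D)⁻¹` for an invertible square matrix. -/
theorem inv_mul_inv_conjTranspose_eq_inv_gram {n : Type} [Fintype n] [DecidableEq n] (D : Matrix n n ℂ) :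
    D⁻¹ * (D⁻¹)ᴴ = (Dᴴ * D)⁻¹ := by
  rw [Matrix.mul_inv_rev, conjTranspose_nonsing_inv]

/-- The complementary principal block of `Dᴴ D` is the Gram matrix of the corresponding columns of `D`. -/
theorem gram_submatrix_eq {n : Type} [Fintype n] [DecidableEq n] {k : ℕ} (D : Matrix n n ℂ) (J : Fin k → n) :
    (Dᴴ * D).submatrix J J = (D.submatrix id J)ᴴ * D.submatrix id J := by
  ext a b
  simp [Matrix.mul_apply, submatrix_apply, conjTranspose_apply]

/-- Measurability of the determinant of a matrix of measurable functions. -/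
theorem measurable_det_of_measurable {Ω : Type*} [MeasurableSpace Ω] {r : ℕ} (A : Ω → Matrix (Fin r) (Fin r) ℂ)
    (hA : ∀ a b, Measurable fun ω => A ω a b) : Measurable fun ω => (A ω).det := by
  have h : (fun ω => (A ω).det) = fun ω => ∑ σ : Equiv.Perm (Fin r), (Equiv.Perm.sign σ : ℂ) * ∏ i, A ω (σ i) i := by
    funext ω; rw [Matrix.det_apply']
  rw [h]
  exact Finset.measurable_sum _ fun σ _ => (Finset.measurable_prod _ fun i _ => hA _ _).const_mul _

include hNeg hJac hCols in
omit [NeZero L] in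
/-- **Integrability conjunct of `GramMoments` for every minor size `r` (single-flavour rows)**, modulo the three inputs:
for `1/2 < q < (1+s₀)/2`, every `N_f`, torus of side `L ≥ 4`, `β`, mass vector, flavour `f`, `r` and rows
`I : Fin r → QuarkIdx L`, the `q`-th power of the principal Gram minor `Re det((GGᴴ)[(f,I),(f,I)])` is integrable under
`qcdLatticeMeasure`. -/
theorem gramMomentIntegrable_of :
    ∃ s₀ : ℝ, 0 < s₀ ∧ ∀ q : ℝ, 1 / 2 < q → q < (1 + s₀) / 2 → ∀ (Nf L : ℕ) [NeZero L], 4 ≤ L →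
      ∀ (β : ℝ) (mq : Fin Nf → ℝ) (f : Fin Nf) (r : ℕ) (I : Fin r → TorusSite 4 L × Fin 3 × Fin 4),
        Integrable (fun U : GaugeConfig 4 L SU3 =>
          (Matrix.of fun a b : Fin r =>
            ((diracMatrix U mq)⁻¹ * ((diracMatrix U mq)⁻¹).conjTranspose)
              (quarkEquiv (f, I a)) (quarkEquiv (f, I b))).det.re ^ q) (qcdLatticeMeasure L β mq) := by
  obtain ⟨s₀, hs₀, hneg⟩ := hNeg
  refine ⟨s₀, hs₀, fun q hq hqs Nf L _ hL β mq f r I => ?_⟩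
  haveI := isProbabilityMeasure_qcdLatticeMeasure_all (S := L) β mq
  have hq0 : 0 < q := by linarith
  set s : ℝ := 2 * q - 1 with hsdef
  have hs : 0 < s := by rw [hsdef]; linarith
  have hss : s < s₀ := by rw [hsdef]; linarith
  -- notation
  set Φ : GaugeConfig 4 L SU3 → Matrix (Fin r) (Fin r) ℂ := fun U => Matrix.of fun a b : Fin r =>
    ((diracMatrix U mq)⁻¹ * ((diracMatrix U mq)⁻¹).conjTranspose) (quarkEquiv (f, I a)) (quarkEquiv (f, I b)) with hΦ
  -- measurability of the integrand
  have hentry : ∀ i j : FermiIdx Nf L, Measurable fun U : GaugeConfig 4 L SU3 => (diracMatrix U mq)⁻¹ i j := by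
    intro i j
    have hadj : Continuous fun U : GaugeConfig 4 L SU3 => (diracMatrix U mq).adjugate i j :=
      ((continuous_diracMatrix (S := L) mq).matrix_adjugate).matrix_elem i j
    have h1 : (fun U : GaugeConfig 4 L SU3 => (diracMatrix U mq)⁻¹ i j) =
        fun U => ((diracMatrix U mq).det)⁻¹ * (diracMatrix U mq).adjugate i j := by
      funext U; rw [Matrix.inv_def, Matrix.smul_apply, smul_eq_mul, Ring.inverse_eq_inv']
    rw [h1]
    exact ((continuous_det_diracMatrix (S := L) mq).measurable.inv).mul hadj.measurable
  have hΦm : ∀ a b, Measurable fun U => Φ U a b := by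
    intro a b
    simp only [hΦ, Matrix.of_apply, Matrix.mul_apply, conjTranspose_apply]
    exact Finset.measurable_sum _ fun l _ => (hentry _ _).mul (continuous_star.measurable.comp (hentry _ _))
  have hFm : Measurable fun U : GaugeConfig 4 L SU3 => (Φ U).det.re ^ q :=
    (Complex.measurable_re.comp (measurable_det_of_measurable Φ hΦm)).pow_const _
  -- non-injective rows: the minor vanishes identically
  by_cases hI : Function.Injective I
  swap
  · have hzero : ∀ U, (Φ U).det = 0 := by
      intro U
      simp only [Function.Injective, not_forall] at hI
      obtain ⟨a, b, hab, hne⟩ := hI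
      exact Matrix.det_zero_of_row_eq hne (funext fun c => by simp only [hΦ, Matrix.of_apply, hab])
    have : (fun U : GaugeConfig 4 L SU3 => (Φ U).det.re ^ q) = fun _ => 0 := by
      funext U; rw [hzero U, Complex.zero_re, Real.zero_rpow hq0.ne']
    simp only [hΦ] at this
    rw [this]
    exact integrable_const 0
  -- complement enumeration, reference matrices and bounds
  obtain ⟨k, J, hJ, hIJ, hcov⟩ := exists_compl_enum I
  set Df : GaugeConfig 4 L SU3 → Matrix (QuarkIdx L) (QuarkIdx L) ℂ :=
    fun U => wilsonDirac (fundamentalRep (Fin 3)) U (mq f) 1 with hDf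
  have hDfc : Continuous Df := continuous_wilsonDirac (fundamentalRep (Fin 3)) (continuous_fundamentalRep (Fin 3)) (mq f) 1
  -- `C ≥ |det((D_fᴴD_f)[J,J])|`
  have hCc : Continuous fun U => ‖(((Df U).submatrix id J)ᴴ * (Df U).submatrix id J).det‖ :=
    (((hDfc.matrix_submatrix id J).matrix_conjTranspose.matrix_mul (hDfc.matrix_submatrix id J)).matrix_det).norm
  obtain ⟨C, hC⟩ : ∃ C : ℝ, ∀ U : GaugeConfig 4 L SU3,
      ‖(((Df U).submatrix id J)ᴴ * (Df U).submatrix id J).det‖ ≤ C := by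
    obtain ⟨U₀, -, hU₀⟩ := (isCompact_univ (X := GaugeConfig 4 L SU3)).exists_isMaxOn Set.univ_nonempty
      hCc.continuousOn
    exact ⟨_, fun U => hU₀ (Set.mem_univ U)⟩
  have hC0 : 0 ≤ C := (norm_nonneg _).trans (hC (fun _ => 1))
  -- `B ≥ ∏_{g ≠ f} |det D_g|`
  have hBc : Continuous fun U : GaugeConfig 4 L SU3 =>
      ∏ g ∈ Finset.univ.erase f, ‖(wilsonDirac (fundamentalRep (Fin 3)) U (mq g) 1).det‖ :=
    continuous_finsetProd _ fun g _ =>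
      ((continuous_wilsonDirac (fundamentalRep (Fin 3)) (continuous_fundamentalRep (Fin 3)) (mq g) 1)
        |>.matrix_det).norm
  obtain ⟨B, hB⟩ : ∃ B : ℝ, ∀ U : GaugeConfig 4 L SU3,
      ∏ g ∈ Finset.univ.erase f, ‖(wilsonDirac (fundamentalRep (Fin 3)) U (mq g) 1).det‖ ≤ B := by
    obtain ⟨U₀, -, hU₀⟩ := (isCompact_univ (X := GaugeConfig 4 L SU3)).exists_isMaxOn Set.univ_nonempty
      hBc.continuousOn
    exact ⟨_, fun U => hU₀ (Set.mem_univ U)⟩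
  have hB0 : 0 ≤ B := (Finset.prod_nonneg fun g _ => norm_nonneg _).trans (hB (fun _ => 1))
  -- the pointwise domination of the reweighted integrand
  have hdom : ∀ U : GaugeConfig 4 L SU3,
      (∏ g, ‖(wilsonDirac (fundamentalRep (Fin 3)) U (mq g) 1).det‖) * |(Φ U).det.re ^ q| ≤
        B * C ^ q * ‖(Df U).det‖ ^ (-s) := by
    intro U
    have hprod : ∏ g, ‖(wilsonDirac (fundamentalRep (Fin 3)) U (mq g) 1).det‖ =
        ‖(Df U).det‖ * ∏ g ∈ Finset.univ.erase f, ‖(wilsonDirac (fundamentalRep (Fin 3)) U (mq g) 1).det‖ :=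
      (Finset.mul_prod_erase _ _ (Finset.mem_univ f)).symm
    have hRHS0 : 0 ≤ B * C ^ q * ‖(Df U).det‖ ^ (-s) :=
      mul_nonneg (mul_nonneg hB0 (Real.rpow_nonneg hC0 _)) (Real.rpow_nonneg (norm_nonneg _) _)
    by_cases hall : ∀ g, (wilsonDirac (fundamentalRep (Fin 3)) U (mq g) 1).det ≠ 0
    · -- off the singular set: Jacobi
      have hdetf : (Df U).det ≠ 0 := hall f
      set M : Matrix (QuarkIdx L) (QuarkIdx L) ℂ := (Df U)ᴴ * Df U with hM
      have hMdet : M.det = star (Df U).det * (Df U).det := by rw [hM, det_mul, det_conjTranspose]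
      have hMdet0 : M.det ≠ 0 := by rw [hMdet]; exact mul_ne_zero (star_ne_zero.2 hdetf) hdetf
      have hnormM : ‖M.det‖ = ‖(Df U).det‖ ^ 2 := by rw [hMdet, norm_mul, norm_star, sq]
      have hMJ : (M.submatrix J J).det ≠ 0 := by
        rw [hM, gram_submatrix_eq]
        exact hCols (QuarkIdx L) k (Df U) J hJ hdetf
      have hΦU : Φ U = (M⁻¹).submatrix I I := by
        ext a b
        simp only [hΦ, Matrix.of_apply, submatrix_apply]
        rw [inv_diracMatrix_mul_conjTranspose_apply_same_flavour U mq hall f, hM,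
          ← inv_mul_inv_conjTranspose_eq_inv_gram]
      have hJacU := hJac (QuarkIdx L) r k M I J hI hJ hIJ hcov hMdet0 hMJ
      -- `|det Φ| = |det M[J,J]| / |det D_f|²`
      have hnormΦ : ‖(Φ U).det‖ = ‖(M.submatrix J J).det‖ / ‖(Df U).det‖ ^ 2 := by
        rw [eq_div_iff (pow_ne_zero 2 (norm_ne_zero_iff.2 hdetf)), ← hnormM, ← norm_mul, hΦU, hJacU]
      have hCJ : ‖(M.submatrix J J).det‖ ≤ C := by rw [hM, gram_submatrix_eq]; exact hC U
      have hdpos : 0 < ‖(Df U).det‖ := norm_pos_iff.2 hdetf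
      -- `|(re z)^q| ≤ |re z|^q ≤ ‖z‖^q ≤ (C / |det D_f|²)^q`
      have hre : |(Φ U).det.re ^ q| ≤ ‖(Φ U).det‖ ^ q :=
        (Real.abs_rpow_le_abs_rpow _ _).trans
          (Real.rpow_le_rpow (abs_nonneg _) (Complex.abs_re_le_norm _) hq0.le)
      have hΦq : ‖(Φ U).det‖ ^ q ≤ C ^ q * ‖(Df U).det‖ ^ (-(2 * q)) := by
        rw [hnormΦ, Real.div_rpow (norm_nonneg _) (pow_nonneg (norm_nonneg _) 2)]
        rw [div_eq_mul_inv, ← Real.rpow_natCast, ← Real.rpow_mul (norm_nonneg _), ← Real.rpow_neg (norm_nonneg _)]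
        push_cast
        gcongr
      have hkey : ‖(Df U).det‖ * ‖(Df U).det‖ ^ (-(2 * q)) = ‖(Df U).det‖ ^ (-s) := by
        conv_lhs => rw [← Real.rpow_one ‖(Df U).det‖]
        rw [← Real.rpow_mul hdpos.le, one_mul, ← Real.rpow_add hdpos, hsdef]
        congr 1; ring
      calc (∏ g, ‖(wilsonDirac (fundamentalRep (Fin 3)) U (mq g) 1).det‖) * |(Φ U).det.re ^ q|
          ≤ (‖(Df U).det‖ * B) * (C ^ q * ‖(Df U).det‖ ^ (-(2 * q))) := by
            rw [hprod]
            exact mul_le_mul (mul_le_mul_of_nonneg_left (hB U) (norm_nonneg _)) (hre.trans hΦq) (abs_nonneg _)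
              (mul_nonneg (norm_nonneg _) hB0)
        _ = B * C ^ q * (‖(Df U).det‖ * ‖(Df U).det‖ ^ (-(2 * q))) := by ring
        _ = B * C ^ q * ‖(Df U).det‖ ^ (-s) := by rw [hkey]
    · -- on the singular set the density vanishes
      push Not at hall
      obtain ⟨g, hg⟩ := hall
      have h0 : ∏ g, ‖(wilsonDirac (fundamentalRep (Fin 3)) U (mq g) 1).det‖ = 0 :=
        Finset.prod_eq_zero (Finset.mem_univ g) (by rw [hg, norm_zero])
      rw [h0, zero_mul]
      exact hRHS0
  -- the dominating function is integrable against the un-normalised Wilson weight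
  obtain ⟨hZ0, hZT⟩ := partitionFunction_fundamental_ne_zero_and_ne_top (S := L) β
  haveI : IsFiniteMeasure (wilsonWeight (d := 4) (L := L) (fundamentalRep (Fin 3)) β) :=
    ⟨by simpa [partitionFunction] using hZT.lt_top⟩
  have hgi : Integrable (fun U : GaugeConfig 4 L SU3 => B * C ^ q * ‖(Df U).det‖ ^ (-s))
      (wilsonWeight (d := 4) (L := L) (fundamentalRep (Fin 3)) β) := by
    have hW : wilsonWeight (d := 4) (L := L) (fundamentalRep (Fin 3)) β =
        partitionFunction (d := 4) (L := L) (fundamentalRep (Fin 3)) β •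
          wilsonMeasure (d := 4) (L := L) (fundamentalRep (Fin 3)) β := by
      rw [wilsonMeasure, smul_smul, ENNReal.mul_inv_cancel hZ0 hZT, one_smul]
    rw [hW]
    exact ((hneg s hs hss L hL β (mq f)).const_mul (B * C ^ q)).smul_measure hZT
  -- integrability against `qcdLatticeWeight = (∏ |det|) · wilsonWeight`
  have hdens : Measurable fun U : GaugeConfig 4 L SU3 =>
      ENNReal.ofReal (∏ g, ‖fermionDet (wilsonDirac (fundamentalRep (Fin 3)) U (mq g) 1)‖) := by
    have := measurable_norm_det_diracMatrix (S := L) mq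
    simp_rw [norm_det_diracMatrix] at this
    exact this.ennreal_ofReal
  have hWint : Integrable (fun U : GaugeConfig 4 L SU3 => (Φ U).det.re ^ q) (qcdLatticeWeight L β mq) := by
    rw [qcdLatticeWeight, integrable_withDensity_iff_integrable_smul' hdens
      (Eventually.of_forall fun _ => ENNReal.ofReal_lt_top)]
    refine hgi.mono' (((hdens.ennreal_toReal).smul hFm).aestronglyMeasurable) (Eventually.of_forall fun U => ?_)
    have h0 : 0 ≤ ∏ g, ‖fermionDet (wilsonDirac (fundamentalRep (Fin 3)) U (mq g) 1)‖ :=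
      Finset.prod_nonneg fun g _ => norm_nonneg _
    rw [ENNReal.toReal_ofReal h0, smul_eq_mul, norm_mul, Real.norm_eq_abs, abs_of_nonneg h0, Real.norm_eq_abs]
    exact hdom U
  -- normalisation
  have huniv : qcdLatticeWeight L β mq Set.univ ≠ 0 := by
    rw [qcdLatticeWeight_univ]
    exact mul_ne_zero hZ0 (ENNReal.ofReal_pos.2 (integral_norm_det_diracMatrix_pos_all (S := L) β mq)).ne'
  simp only [hΦ] at hWint
  rw [qcdLatticeMeasure]
  exact hWint.smul_measure (ENNReal.inv_ne_top.2 huniv)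

end AllR

/-- **stub `stub_gramMomentIntegrableOf` (registered additive stub of crux stmt-QuantumFields-9151)** — the
integrability conjunct of `GramMoments` for every minor size `r` and single-flavour rows, with its three inputs
(negative moments of the Wilson determinant, Jacobi's complementary-minor identity, non-singularity of the Gram matrix
of columns — registered stubs `stub_wilsonDetNegMoment`, `stub_jacobiComplementaryMinor`,
`stub_gramOfColumns_det_ne_zero`, all landed) as explicit hypotheses. -/
theorem stub_gramMomentIntegrableOf :
    (∃ s₀ : ℝ, 0 < s₀ ∧ ∀ s : ℝ, 0 < s → s < s₀ → ∀ (L : ℕ) [NeZero L], 4 ≤ L → ∀ (β M : ℝ),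
      MeasureTheory.Integrable
        (fun U : GaugeConfig 4 L SU3 => ‖(wilsonDirac (fundamentalRep (Fin 3)) U M 1).det‖ ^ (-s))
        (wilsonMeasure (fundamentalRep (Fin 3)) β)) →
    (∀ (n : Type) [Fintype n] [DecidableEq n] (r k : ℕ) (M : Matrix n n ℂ) (I : Fin r → n) (J : Fin k → n),
      Function.Injective I → Function.Injective J → (∀ a b, I a ≠ J b) → (∀ x, (∃ a, I a = x) ∨ (∃ b, J b = x)) →
      M.det ≠ 0 → (M.submatrix J J).det ≠ 0 → ((M⁻¹).submatrix I I).det * M.det = (M.submatrix J J).det) →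
    (∀ (n : Type) [Fintype n] [DecidableEq n] (k : ℕ) (D : Matrix n n ℂ) (J : Fin k → n),
      Function.Injective J → D.det ≠ 0 → ((D.submatrix id J).conjTranspose * D.submatrix id J).det ≠ 0) →
    ∃ s₀ : ℝ, 0 < s₀ ∧ ∀ q : ℝ, 1 / 2 < q → q < (1 + s₀) / 2 → ∀ (Nf L : ℕ) [NeZero L], 4 ≤ L →
      ∀ (β : ℝ) (mq : Fin Nf → ℝ) (f : Fin Nf) (r : ℕ) (I : Fin r → TorusSite 4 L × Fin 3 × Fin 4),
        MeasureTheory.Integrable (fun U : GaugeConfig 4 L SU3 =>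
          (Matrix.of fun a b : Fin r =>
            ((diracMatrix U mq)⁻¹ * ((diracMatrix U mq)⁻¹).conjTranspose)
              (quarkEquiv (f, I a)) (quarkEquiv (f, I b))).det.re ^ q) (qcdLatticeMeasure L β mq) :=
  fun hNeg hJac hCols => gramMomentIntegrable_of hNeg hJac hCols


end Summit.QuantumFields.QCD.Cruxes.PhaseQuenchedFlavourDecay.CrossingSplitIntegrability

end
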